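import Literature.NumberTheory.EllipticCurves.TwoVariableAnticyclotomicControlLocalProofs
import Literature.NumberTheory.EllipticCurves.SubgroupSelmerCocycleCriteriaProofs
import Literature.NumberTheory.GaloisRepresentations.LocalGaloisGroupHenselProofs
import Literature.NumberTheory.GaloisRepresentations.LocalGaloisGroupProofs
import Mathlib.FieldTheory.Finite.GaloisField
import HarnessLib

/-!
# Torsion transfer for line `thin_comb` (crux `AdditiveSplitIMCInclusionAtThree`, stmt-BirchSwinnertonDyer-20395), part I:
# the LOCAL KILLING at a finite place, cocycle level — a killing relation `Σ φᵢ ∘ δⁱ = 0` on the coefficients annihilates the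
# defect between «Greenberg (inertia) condition at `v` over `K̄^{H₂}`» and «strict (decomposition) condition at `v` over `K̄^{H}`»
# (helper for `stub_torsionTransfer`, `--supports stmt-BirchSwinnertonDyer-20395`; cell `pub/bsd-wall`, lead `cruxlead-20395` g5)

WHY. `stub_torsionTransfer` (skeleton v7 of `Cruxes/AdditiveSplitIMCInclusionAtThree/Lines/thin_comb.lean`) transfers
«`X_Gr(E/K̃_∞)` not `Λ₂`-torsion» to «`X_ac` not `Λ`-torsion» through the control map `X_Gr₂ ↠ X_ac` of a 𝔭-adapted frame. The
cokernel side of that control needs, at the prime `𝔭′` where `X_Gr₂` imposes Greenberg's INERTIA condition over `K̃_∞ = K̄^{H₂}`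
and `X_ac` imposes Castella's STRICT (decomposition-group) condition over `K_∞^{ac} = K̄^{H}` (`H₂ ≤ H`), an annihilator of the local
defect `ker(H¹(H ⊓ D_𝔭′, M) → H¹(H₂ ⊓ I_𝔭′, M))`. The sibling crux stmt-…-20727 (line `bdpline`, good supersingular `p`) had this
defect ZERO (Serre's vanishing `M^{H₂ ⊓ I} = 0`, `mem_strictKer_strictDatum_of_resOfLe_mem_greenbergKer`); at the WILD ADDITIVE `3` of
class O6 that vanishing fails in general (`E(ℚ₃^{nr})[3] ≠ 0` occurs with surjective `ρ̄₃`). This file proves an annihilator that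
needs NO hypothesis on `M` at the place (its companion `…TorsionTransferLocalKilling.lean` feeds it the Cayley–Hamilton polynomial of
`δ` on `E[p^∞]`):

* §1 (generic cocycle algebra, any field `K`, any discrete `Γ_K`-module `M`, `H` normal) `sum_apply_subgroupConj_eq_zero`:
  let `z` be a continuous cocycle on `H` which is a coboundary `∂a₀` on a subgroup `N ≤ Γ_K` (elementwise), `δ ∈ Γ_K`, and
  additive `Γ_K`-equivariant `φᵢ : M → M` with the KILLING relation `Σ_{i∈s} φᵢ(δ^i • m) = 0` for all `m`. If `x ∈ H` satisfies
  `δ^{-i} x δ^{i} x⁻¹ ∈ H ∩ N` (`i ∈ s`) and `x⁻¹ N x ⊆ N`, then `Σ_{i∈s} φᵢ(δ^i • z(δ^{-i} x δ^i)) = 0` — the value at `x` of the cocycle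
  representing `Σᵢ H¹(φᵢ)(conj_{δ^i} [z])`.
* §2 `sum_conjH1_mem_strictKer` (class level): for normal `H₂ ≤ H ≤ Γ_K`, a finite place `v`, `δ` with
  `δ^{-i} g δ^{i} g⁻¹ ∈ H₂ ⊓ I_v` for `g ∈ H ⊓ D_v`, and `a ∈ H¹(H, M)` whose restriction to `H₂` satisfies Greenberg's condition for the
  strict datum at `v` (`(strictDatum M v).greenbergKer H₂`), the class `Σ_{i∈s} H¹(φᵢ)(conj_{δ^i} a)` satisfies the STRICT condition at
  `v` over `K̄^H` (`(strictDatum M v).strictKer H`); `H¹(φ)` (= `resH1Hom` along `(id_H, φ)`) commutes with conjugation and restriction.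
* §3 `inv_mul_mul_mul_inv_mem_inertia` — `[D_v, D_v] ⊆ I_v` (the Frobenius quotient of a local Galois group is abelian; re-derived from
  Mathlib's `Ideal.Quotient.stabilizerHom` and the tree's local absolute Galois library so that this file imports no `Theses`), and
  `pow_inv_mul_conj_mem` — the hypothesis of §2 from `[Γ_K, Γ_K] ⊆ H₂` (e.g. `H₂ = ker κ₁ ⊓ ker κ₂`, `inv_mul_mul_mul_inv_mem_pairKer`)
  and `[D_v, D_v] ⊆ I_v`.

Pure Galois-cohomological bookkeeping on the tree's CONSTRUCTED carriers; no definition, no named fact, no `sorry`;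
nothing about BSD or the crux is asserted here.

References: [SerreLocalFields1979] Ch. I §7 Prop. 20–21, §8 (`D/I ≅ Gal(k̄/k)`), VII.§5 Prop. 3, VII.§6 Prop. 4; [SkinnerUrban2014]
Prop. 3.2.8 (p. 23, the local analysis of control); [GreenbergLNM1716] §3 Lemmas 3.2–3.3; [NeukirchSchmidtWingberg2008] I.§5.
-/

set_option linter.dupNamespace false
set_option autoImplicit false

noncomputable section

open scoped Classical

open NumberField IsDedekindDomain Field
open Literature.NumberTheory.EllipticCurves Literature.NumberTheory.EllipticCurves.GreenbergSelmer
  Literature.NumberTheory.GaloisRepresentations Literature.NumberTheory.EllipticCurves.Castella2018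

universe u

namespace Summit.BirchSwinnertonDyer.BirchSwinnertonDyer.Theorems.UniversalToricDescentThinComb.TorsionTransferLocal

/-! ## §1 Generic cocycle algebra -/

section Cocycle

variable {K : Type u} [Field K]
  {M : Type u} [AddCommGroup M] [DistribMulAction (absoluteGaloisGroup K) M]
  [TopologicalSpace M] [DiscreteTopology M]
  {H : Subgroup (absoluteGaloisGroup K)}

/-- The crossed-homomorphism identity on `H`, action written through `Γ_K`. [cite: SerreLocalFields1979, VII.§5] -/
theorem cocycle_mul' (z : contOneCocycles (discreteTopRep H M)) (a b : H) :
    z.1 (a * b) = z.1 a + (a : absoluteGaloisGroup K) • z.1 b :=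
  z.2 a b

/-- **The defect `z' = z − ∂a₀` is `N`-invariant and `N`-periodic.** If `z(t) = t•a₀ − a₀` for every `t ∈ H` lying in `N`,
then for `x ∈ H` with `x⁻¹ N x ⊆ N` and `n ∈ H ∩ N`: `z(n x) − ((n x)•a₀ − a₀) = z(x) − (x•a₀ − a₀)`.
[cite: SerreLocalFields1979, VII.§5 Prop. 3] -/
theorem apply_mul_sub_eq (z : contOneCocycles (discreteTopRep H M)) {N : Subgroup (absoluteGaloisGroup K)} {a₀ : M}
    (hzN : ∀ t : H, (t : absoluteGaloisGroup K) ∈ N → z.1 t = (t : absoluteGaloisGroup K) • a₀ - a₀)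
    (x n : H) (hn : (n : absoluteGaloisGroup K) ∈ N)
    (hNx : ∀ g ∈ N, (x : absoluteGaloisGroup K)⁻¹ * g * x ∈ N) :
    z.1 (n * x) - (((n * x : H) : absoluteGaloisGroup K) • a₀ - a₀) =
      z.1 x - ((x : absoluteGaloisGroup K) • a₀ - a₀) := by
  -- `n x = x n'` with `n' = x⁻¹ n x ∈ N`
  obtain ⟨n', hn'⟩ : ∃ n' : H, n' = x⁻¹ * n * x := ⟨_, rfl⟩
  have hn'N : (n' : absoluteGaloisGroup K) ∈ N := by
    rw [hn', Subgroup.coe_mul, Subgroup.coe_mul, Subgroup.coe_inv]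
    exact hNx _ hn
  have hxn' : n * x = x * n' := by rw [hn']; group
  have hcoe : ((x * n' : H) : absoluteGaloisGroup K) = (x : absoluteGaloisGroup K) * n' := rfl
  rw [hxn', cocycle_mul', hzN n' hn'N, hcoe, mul_smul, smul_sub]
  abel

variable [H.Normal] in
/-- **Conjugate values.** Under the hypotheses of `apply_mul_sub_eq`, if `δ'⁻¹ x δ' = n x` with `n ∈ H ∩ N`, then
`δ' • z(δ'⁻¹ x δ') = δ' • (z(x) − (x•a₀ − a₀)) + x • (δ' • a₀) − δ' • a₀`. [cite: SerreLocalFields1979, VII.§5 Prop. 3] -/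
theorem smul_apply_subgroupConj_eq (z : contOneCocycles (discreteTopRep H M)) {N : Subgroup (absoluteGaloisGroup K)}
    {a₀ : M} (hzN : ∀ t : H, (t : absoluteGaloisGroup K) ∈ N → z.1 t = (t : absoluteGaloisGroup K) • a₀ - a₀)
    (x : H) (hNx : ∀ g ∈ N, (x : absoluteGaloisGroup K)⁻¹ * g * x ∈ N) (δ' : absoluteGaloisGroup K)
    (hδx : δ'⁻¹ * x * δ' * (x : absoluteGaloisGroup K)⁻¹ ∈ N) (hδH : δ'⁻¹ * x * δ' * (x : absoluteGaloisGroup K)⁻¹ ∈ H) :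
    δ' • z.1 (subgroupConj H δ' x) =
      δ' • (z.1 x - ((x : absoluteGaloisGroup K) • a₀ - a₀)) + (x : absoluteGaloisGroup K) • (δ' • a₀) - δ' • a₀ := by
  set n : H := ⟨δ'⁻¹ * x * δ' * (x : absoluteGaloisGroup K)⁻¹, hδH⟩ with hn
  have hconj : subgroupConj H δ' x = n * x :=
    Subtype.ext (by rw [subgroupConj_apply_coe, Subgroup.coe_mul, hn]; group)
  have key := apply_mul_sub_eq z hzN x n hδx hNx
  have hval : z.1 (n * x) = (z.1 x - ((x : absoluteGaloisGroup K) • a₀ - a₀)) +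
      (((n * x : H) : absoluteGaloisGroup K) • a₀ - a₀) := by rw [← key]; abel
  have hnx : ((n * x : H) : absoluteGaloisGroup K) = δ'⁻¹ * x * δ' := by
    rw [Subgroup.coe_mul, hn]; group
  have hprod : δ' * (δ'⁻¹ * (x : absoluteGaloisGroup K) * δ') = (x : absoluteGaloisGroup K) * δ' := by group
  rw [hconj, hval, hnx]
  simp only [smul_add, smul_sub, smul_smul, hprod]
  abel

variable [H.Normal] in
/-- **§1 main: the killing relation annihilates the conjugate-sum at every `x` normalising the picture.** With `z`, `N`, `a₀` as
above, `δ ∈ Γ_K`, a finite set `s` of exponents and additive `Γ_K`-equivariant `φ_i : M → M` with `Σ_{i∈s} φ_i(δ^i • m) = 0` for all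
`m`: for every `x ∈ H` with `x⁻¹ N x ⊆ N` and `δ^{-i} x δ^{i} x⁻¹ ∈ H ∩ N` (`i ∈ s`),
`Σ_{i∈s} φ_i(δ^i • z(δ^{-i} x δ^i)) = 0`. [cite: SkinnerUrban2014, Prop. 3.2.8 (p. 23)] -/
theorem sum_apply_subgroupConj_eq_zero (z : contOneCocycles (discreteTopRep H M)) {N : Subgroup (absoluteGaloisGroup K)}
    {a₀ : M} (hzN : ∀ t : H, (t : absoluteGaloisGroup K) ∈ N → z.1 t = (t : absoluteGaloisGroup K) • a₀ - a₀)
    (δ : absoluteGaloisGroup K) (s : Finset ℕ) (φ : ℕ → M →+ M)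
    (hφ : ∀ (i : ℕ) (g : absoluteGaloisGroup K) (m : M), φ i (g • m) = g • φ i m)
    (hkill : ∀ m : M, ∑ i ∈ s, φ i (δ ^ i • m) = 0)
    (x : H) (hNx : ∀ g ∈ N, (x : absoluteGaloisGroup K)⁻¹ * g * x ∈ N)
    (hδx : ∀ i ∈ s, (δ ^ i)⁻¹ * x * δ ^ i * (x : absoluteGaloisGroup K)⁻¹ ∈ N)
    (hδH : ∀ i ∈ s, (δ ^ i)⁻¹ * x * δ ^ i * (x : absoluteGaloisGroup K)⁻¹ ∈ H) :
    ∑ i ∈ s, φ i (δ ^ i • z.1 (subgroupConj H (δ ^ i) x)) = 0 := by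
  have hterm : ∀ i ∈ s, φ i (δ ^ i • z.1 (subgroupConj H (δ ^ i) x)) =
      φ i (δ ^ i • (z.1 x - ((x : absoluteGaloisGroup K) • a₀ - a₀))) +
        ((x : absoluteGaloisGroup K) • φ i (δ ^ i • a₀) - φ i (δ ^ i • a₀)) := by
    intro i hi
    rw [smul_apply_subgroupConj_eq z hzN x hNx (δ ^ i) (hδx i hi) (hδH i hi), map_sub, map_add,
      hφ i (x : absoluteGaloisGroup K), add_sub_assoc]
  rw [Finset.sum_congr rfl hterm, Finset.sum_add_distrib, Finset.sum_sub_distrib, ← Finset.smul_sum, hkill, hkill, smul_zero,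
    sub_zero, add_zero]

end Cocycle

/-! ## §2 Class level: the strict condition at `v` for the conjugate-sum -/

section ClassLevel

variable {K : Type u} [Field K]
  {M : Type u} [AddCommGroup M] [DistribMulAction (absoluteGaloisGroup K) M]
  [TopologicalSpace M] [DiscreteTopology M]
  {H H₂ : Subgroup (absoluteGaloisGroup K)}

variable [H.Normal] in
/-- The endomorphism `H¹(φ)` of `H¹(H, M)` induced by an additive `Γ_K`-equivariant `φ : M → M` (`resH1Hom` along `(id_H, φ)`; for
`φ = (c • ·)` the tree's `scalarH1`) commutes with conjugation (both composites are induced by `(h ↦ σ⁻¹ h σ, φ ∘ σ = σ ∘ φ)`).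
[cite: NeukirchSchmidtWingberg2008, I.§5] -/
theorem conjH1_comp_resH1Hom_id (φ : M →+ M) (hφ : ∀ (g : absoluteGaloisGroup K) (m : M), φ (g • m) = g • φ m)
    (σ : absoluteGaloisGroup K) :
    (conjH1 H M σ).comp (resH1Hom (ContinuousMonoidHom.id H) φ (fun x m ↦ hφ (x : absoluteGaloisGroup K) m)) =
      (resH1Hom (ContinuousMonoidHom.id H) φ (fun x m ↦ hφ (x : absoluteGaloisGroup K) m)).comp (conjH1 H M σ) := by
  rw [conjH1, resH1Hom_comp, resH1Hom_comp]
  exact resH1Hom_congr (by ext; rfl) (by ext m; simp [hφ]) _ _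

/-- `H¹(φ)` commutes with restriction. [cite: NeukirchSchmidtWingberg2008, I.§5] -/
theorem resOfLe_comp_resH1Hom_id {H' : Subgroup (absoluteGaloisGroup K)} (hle : H' ≤ H) (φ : M →+ M)
    (hφ : ∀ (g : absoluteGaloisGroup K) (m : M), φ (g • m) = g • φ m) :
    (resOfLe M hle).comp (resH1Hom (ContinuousMonoidHom.id H) φ (fun x m ↦ hφ (x : absoluteGaloisGroup K) m)) =
      (resH1Hom (ContinuousMonoidHom.id H') φ (fun x m ↦ hφ (x : absoluteGaloisGroup K) m)).comp (resOfLe M hle) := by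
  rw [resOfLe, resH1Hom_comp, resH1Hom_comp]
  exact resH1Hom_congr (by ext; rfl) (by ext; rfl) _ _

variable [NumberField K] [H.Normal] [H₂.Normal] in
/-- **§2 main: the conjugate-sum of a class unramified at `v` over `K̄^{H₂}` is STRICT at `v` over `K̄^{H}`.** Let `H₂ ≤ H` be normal
subgroups of `Γ_K`, `v` a finite place, `δ ∈ D_v` with `δ^{-i} g δ^{i} g⁻¹ ∈ H₂ ⊓ I_v` for all `g ∈ H ⊓ D_v` and `i ∈ s`, and
`φ_i` additive `Γ_K`-equivariant with `Σ_{i∈s} φ_i(δ^i • m) = 0` on `M`. If `a ∈ H¹(H, M)` restricts into Greenberg's kernel for the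
strict datum at `v` over `K̄^{H₂}` (`res_{H₂ ⊓ I_v}(res a) = 0`), then `Σ_{i∈s} H¹(φ_i)(conj_{δ^i} a)` dies in `H¹(H ⊓ D_v, M)`
(`(strictDatum M v).strictKer H`). [cite: SkinnerUrban2014, Prop. 3.2.8 (p. 23)] [cite: SerreLocalFields1979, VII.§6 Prop. 4] -/
theorem sum_conjH1_mem_strictKer (hle : H₂ ≤ H) {v : HeightOneSpectrum (𝓞 K)} {δ : absoluteGaloisGroup K}
    {s : Finset ℕ}
    (hδ : ∀ g ∈ H ⊓ decomp v, ∀ i ∈ s, (δ ^ i)⁻¹ * g * δ ^ i * g⁻¹ ∈ H₂ ⊓ inertia v)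
    (φ : ℕ → M →+ M) (hφ : ∀ (i : ℕ) (g : absoluteGaloisGroup K) (m : M), φ i (g • m) = g • φ i m)
    (hkill : ∀ m : M, ∑ i ∈ s, φ i (δ ^ i • m) = 0)
    {a : subgroupH1 H M} (ha : resOfLe M hle a ∈ (AcSelmer.strictDatum M v).greenbergKer H₂) :
    (∑ i ∈ s, resH1Hom (ContinuousMonoidHom.id H) (φ i) (fun x m ↦ hφ i (x : absoluteGaloisGroup K) m) (conjH1 H M (δ ^ i) a)) ∈
      (AcSelmer.strictDatum M v).strictKer H := by
  obtain ⟨z, rfl⟩ := oneCocycleClass_surjective _ a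
  -- the Greenberg condition downstairs, on the cocycle: `z = ∂ā` on `H₂ ⊓ I_v`, valued in `M ⧸ ⊥`
  rw [LocalDatum.mem_greenbergKer_iff, LocalDatum.greenbergMap, ← AddMonoidHom.comp_apply, resOfLe,
    resH1Hom_comp, CocycleCriteria.resH1Hom_oneCocycleClass_eq_zero_iff] at ha
  obtain ⟨abar, habar⟩ := ha
  obtain ⟨a₀, rfl⟩ := (AcSelmer.strictDatum M v).grMk_surjective abar
  set N : Subgroup (absoluteGaloisGroup K) := H₂ ⊓ inertia v with hN
  have hinj : ∀ m m' : M, (AcSelmer.strictDatum M v).grMk m = (AcSelmer.strictDatum M v).grMk m' → m = m' := by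
    intro m m' hmm'
    rw [← sub_eq_zero, ← map_sub, ← AddMonoidHom.mem_ker, LocalDatum.ker_grMk] at hmm'
    have h0 : m - m' ∈ (⊥ : AddSubgroup M) := hmm'
    rwa [AddSubgroup.mem_bot, sub_eq_zero] at h0
  have hzN : ∀ t : H, (t : absoluteGaloisGroup K) ∈ N → z.1 t = (t : absoluteGaloisGroup K) • a₀ - a₀ := by
    intro t ht
    have htI : (⟨(t : absoluteGaloisGroup K), inertia_le_decomp v (Subgroup.mem_inf.mp ht).2⟩ : decomp (K := K) v) ∈
        inertiaIn H₂ v := (mem_inertiaIn_iff H₂ v _).2 (Subgroup.mem_inf.mp ht)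
    have h := habar ⟨_, htI⟩
    have ht' : ((subgroupInclusion hle).comp (inertiaInToH H₂ v)) ⟨_, htI⟩ = t := Subtype.ext rfl
    rw [ht'] at h
    change (AcSelmer.strictDatum M v).grMk (z.1 t) =
      (⟨(t : absoluteGaloisGroup K), inertia_le_decomp v (Subgroup.mem_inf.mp ht).2⟩ : decomp (K := K) v) •
        (AcSelmer.strictDatum M v).grMk a₀ - (AcSelmer.strictDatum M v).grMk a₀ at h
    rw [LocalDatum.smul_grMk, ← map_sub] at h
    exact hinj _ _ h
  -- the compatibility of the pair defining `conjH1`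
  have hcc : ∀ (σ : absoluteGaloisGroup K) (y : H) (m : M),
      DistribSMul.toAddMonoidHom M σ (subgroupConj H σ y • m) = y • DistribSMul.toAddMonoidHom M σ m := fun σ y m ↦ by
    simp only [DistribSMul.toAddMonoidHom_apply, Subgroup.smul_def, subgroupConj_apply_coe, smul_smul, mul_assoc,
      mul_inv_cancel_left]
  -- the class of the conjugate-sum is represented by the explicit cocycle sum
  have hrepr : ∀ i : ℕ, resH1Hom (ContinuousMonoidHom.id H) (φ i) (fun x m ↦ hφ i (x : absoluteGaloisGroup K) m)
        (conjH1 H M (δ ^ i) (oneCocycleClass _ z)) =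
      oneCocycleClass _ (contOneCocycles.pullback (ContinuousMonoidHom.id H)
        (resHomOfEquivariant (ContinuousMonoidHom.id H) (φ i) (fun x m ↦ hφ i (x : absoluteGaloisGroup K) m))
        (contOneCocycles.pullback (subgroupConj H (δ ^ i))
          (resHomOfEquivariant (subgroupConj H (δ ^ i)) (DistribSMul.toAddMonoidHom M (δ ^ i))
            (hcc (δ ^ i))) z)) := by
    intro i
    have h1 : conjH1 H M (δ ^ i) (oneCocycleClass _ z) = oneCocycleClass _ (contOneCocycles.pullback (subgroupConj H (δ ^ i))
          (resHomOfEquivariant (subgroupConj H (δ ^ i)) (DistribSMul.toAddMonoidHom M (δ ^ i))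
            (hcc (δ ^ i))) z) :=
      map_oneCocycleClass _ _ _ z
    rw [h1]
    exact map_oneCocycleClass _ _ _ _
  set wz : ℕ → contOneCocycles (discreteTopRep H M) := fun i ↦ contOneCocycles.pullback (ContinuousMonoidHom.id H)
        (resHomOfEquivariant (ContinuousMonoidHom.id H) (φ i) (fun x m ↦ hφ i (x : absoluteGaloisGroup K) m))
        (contOneCocycles.pullback (subgroupConj H (δ ^ i))
          (resHomOfEquivariant (subgroupConj H (δ ^ i)) (DistribSMul.toAddMonoidHom M (δ ^ i))
            (hcc (δ ^ i))) z) with hwz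
  have hsum : (∑ i ∈ s, resH1Hom (ContinuousMonoidHom.id H) (φ i) (fun x m ↦ hφ i (x : absoluteGaloisGroup K) m)
      (conjH1 H M (δ ^ i) (oneCocycleClass _ z))) = oneCocycleClass _ (∑ i ∈ s, wz i) := by
    have h' : ∀ i ∈ s, resH1Hom (ContinuousMonoidHom.id H) (φ i) (fun x m ↦ hφ i (x : absoluteGaloisGroup K) m)
        (conjH1 H M (δ ^ i) (oneCocycleClass _ z)) = oneCocycleClassₗ (discreteTopRep H M) (wz i) := fun i _ ↦ hrepr i
    rw [Finset.sum_congr rfl h', ← map_sum]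
    rfl
  have hwz_apply : ∀ (i : ℕ) (x : H), (wz i).1 x = φ i (δ ^ i • z.1 (subgroupConj H (δ ^ i) x)) := fun i x ↦ rfl
  have hsum_apply : ∀ (t : Finset ℕ) (x : H), (∑ i ∈ t, wz i).1 x = ∑ i ∈ t, (wz i).1 x := by
    intro t x
    induction t using Finset.cons_induction with
    | empty => simp
    | cons a t hat ih => rw [Finset.sum_cons, Finset.sum_cons, ← ih]; rfl
  rw [hsum, LocalDatum.mem_strictKer_iff, LocalDatum.strictMap, CocycleCriteria.resH1Hom_oneCocycleClass_eq_zero_iff]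
  refine ⟨0, fun y ↦ ?_⟩
  rw [smul_zero, sub_zero]
  -- the value of the sum cocycle at `y ∈ H ⊓ D_v` vanishes by §1
  set x : H := decompInToH H v y with hx
  have hxD : (x : absoluteGaloisGroup K) ∈ decomp v := (y : decomp (K := K) v).2
  have hxHD : (x : absoluteGaloisGroup K) ∈ H ⊓ decomp v := Subgroup.mem_inf.mpr ⟨x.2, hxD⟩
  have hval : (∑ i ∈ s, wz i).1 x = ∑ i ∈ s, φ i (δ ^ i • z.1 (subgroupConj H (δ ^ i) x)) := by
    rw [hsum_apply]
    exact Finset.sum_congr rfl fun i _ ↦ hwz_apply i x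
  have hNx : ∀ g ∈ N, (x : absoluteGaloisGroup K)⁻¹ * g * x ∈ N := by
    intro g hg
    refine Subgroup.mem_inf.mpr ⟨?_, inv_mul_mul_mem_inertia v (Subgroup.mem_inf.mp hg).2 hxD⟩
    simpa only [inv_inv] using Subgroup.Normal.conj_mem inferInstance g (Subgroup.mem_inf.mp hg).1
      (x : absoluteGaloisGroup K)⁻¹
  have h0 := sum_apply_subgroupConj_eq_zero z hzN δ s φ hφ hkill x hNx (fun i hi ↦ hδ _ hxHD i hi)
    (fun i hi ↦ hle (Subgroup.mem_inf.mp (hδ _ hxHD i hi)).1)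
  change (AcSelmer.strictDatum M v).grMk ((∑ i ∈ s, wz i).1 x) = 0
  rw [hval, h0, map_zero]

end ClassLevel


/-! ## §3 `[D_v, D_v] ⊆ I_v` and the conjugation hypothesis of §2 -/

section Commutator

open scoped Pointwise
open ValuativeRel Literature.NumberTheory.GaloisRepresentations.IsNonarchimedeanLocalField

/-- Automorphisms of an algebraic extension `L` of a FINITE field `k` commute (on each finite subextension `k⟮x⟯` both are
powers of the Frobenius, Mathlib `FiniteField.bijective_frobeniusAlgEquivOfAlgebraic_pow`; `Gal(k̄/k) ≅ Ẑ` is abelian).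
[cite: SerreLocalFields1979, Ch. I §8 (Galois theory of finite fields)] -/
theorem algEquiv_commute_of_finite {k L : Type*} [Field k] [Finite k] [Field L] [Algebra k L]
    [Algebra.IsAlgebraic k L] (f g : L ≃ₐ[k] L) : Commute f g := by
  haveI := Fintype.ofFinite k
  change f * g = g * f
  apply AlgEquiv.ext
  intro x
  set E : IntermediateField k L := IntermediateField.adjoin k {x} with hE
  haveI : FiniteDimensional k E :=
    IntermediateField.adjoin.finiteDimensional (Algebra.IsIntegral.isIntegral (R := k) x)
  haveI : Finite E := Module.finite_of_finite k
  have hx : x ∈ E := IntermediateField.mem_adjoin_simple_self k x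
  obtain ⟨n, hn⟩ := (FiniteField.bijective_frobeniusAlgEquivOfAlgebraic_pow k E).2 (f.restrictNormal E)
  obtain ⟨m, hm⟩ := (FiniteField.bijective_frobeniusAlgEquivOfAlgebraic_pow k E).2 (g.restrictNormal E)
  have hc : f.restrictNormal E * g.restrictNormal E = g.restrictNormal E * f.restrictNormal E := by
    rw [← hn, ← hm]
    exact (Commute.pow_pow_self _ _ _).eq
  have key : ∀ (h : L ≃ₐ[k] L) (y : E), h (y : L) = ((h.restrictNormal E y : E) : L) :=
    fun h y ↦ (AlgEquiv.restrictNormal_apply E h y).symm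
  calc (f * g) x = f (g ((⟨x, hx⟩ : E) : L)) := rfl
    _ = (((f.restrictNormal E * g.restrictNormal E) ⟨x, hx⟩ : E) : L) := by
        rw [key g, key f, AlgEquiv.mul_apply]
    _ = (((g.restrictNormal E * f.restrictNormal E) ⟨x, hx⟩ : E) : L) := by rw [hc]
    _ = g (f ((⟨x, hx⟩ : E) : L)) := by rw [AlgEquiv.mul_apply, ← key g, ← key f]
    _ = (g * f) x := rfl

set_option maxHeartbeats 400000 in
/-- **The Frobenius quotient of a local absolute Galois group is abelian: `σ⁻¹ τ σ τ⁻¹ ∈ I_F`** (`F` a non-archimedean local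
field). `Γ_F` stabilises the canonical prime `𝔓` of `\bar 𝒪_F` (`smul_absMaximalIdeal_holds`); the induced action on the residue
extension (Mathlib `Ideal.Quotient.stabilizerHom`) has kernel `I_F` (`Ideal.Quotient.ker_stabilizerHom`) and abelian image, any two
automorphisms of an algebraic extension of the FINITE field `𝒪_F/𝓂_F` being powers of Frobenius on each finite subextension
(Mathlib `FiniteField.bijective_frobeniusAlgEquivOfAlgebraic_pow`). (Same argument as the `bsd-eis` cell's `commutator_mem_absInertia`,
re-proved here to keep the import cone `Theses`-free.) [cite: SerreLocalFields1979, Ch. I §7 Prop. 20–21 and §8] -/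
theorem inv_mul_mul_mul_inv_mem_absInertia (F : Type*) [Field F] [ValuativeRel F] [TopologicalSpace F]
    [IsNonarchimedeanLocalField F] (σ τ : absoluteGaloisGroup F) : σ⁻¹ * τ * σ * τ⁻¹ ∈ absInertia F := by
  classical
  haveI hmax : (absMaximalIdeal F).IsMaximal := absMaximalIdeal_isMaximal_holds F
  haveI hfin : Finite (𝒪[F] ⧸ (absMaximalIdeal F).under 𝒪[F]) := by
    rw [under_absMaximalIdeal_holds F]
    exact (inferInstance : Finite 𝓀[F])
  haveI hmax' : ((absMaximalIdeal F).under 𝒪[F]).IsMaximal := Ideal.IsMaximal.under 𝒪[F] (absMaximalIdeal F)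
  letI : Field (𝒪[F] ⧸ (absMaximalIdeal F).under 𝒪[F]) := Ideal.Quotient.field _
  letI : Field (absIntegers 𝒪[F] F ⧸ absMaximalIdeal F) := Ideal.Quotient.field _
  haveI : Algebra.IsIntegral (𝒪[F] ⧸ (absMaximalIdeal F).under 𝒪[F]) (absIntegers 𝒪[F] F ⧸ absMaximalIdeal F) :=
    Ideal.Quotient.algebra_isIntegral_of_liesOver _ _
  haveI halg : Algebra.IsAlgebraic (𝒪[F] ⧸ (absMaximalIdeal F).under 𝒪[F]) (absIntegers 𝒪[F] F ⧸ absMaximalIdeal F) :=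
    Algebra.IsIntegral.isAlgebraic
  have hst : ∀ g : absoluteGaloisGroup F, g ∈ MulAction.stabilizer (absoluteGaloisGroup F) (absMaximalIdeal F) :=
    fun g ↦ smul_absMaximalIdeal_holds F g
  let f := Ideal.Quotient.stabilizerHom (absMaximalIdeal F) ((absMaximalIdeal F).under 𝒪[F]) (absoluteGaloisGroup F)
  let s : MulAction.stabilizer (absoluteGaloisGroup F) (absMaximalIdeal F) := ⟨σ, hst σ⟩
  let t : MulAction.stabilizer (absoluteGaloisGroup F) (absMaximalIdeal F) := ⟨τ, hst τ⟩
  have hcomm : f s * f t = f t * f s := (algEquiv_commute_of_finite (f s) (f t)).eq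
  have hker : s⁻¹ * t * s * t⁻¹ ∈ f.ker := by
    rw [MonoidHom.mem_ker, map_mul, map_mul, map_mul, map_inv, map_inv,
      show (f s)⁻¹ * f t * f s * (f t)⁻¹ = (f s)⁻¹ * (f t * f s) * (f t)⁻¹ by group, ← hcomm]
    group
  rw [Ideal.Quotient.ker_stabilizerHom] at hker
  intro x
  exact hker x

variable {K : Type u} [Field K] [NumberField K]

/-- **`δ⁻¹ g δ g⁻¹ ∈ I_v` for `δ, g ∈ D_v`** (the chosen decomposition / inertia groups at the finite place `v` are the images of
`Γ_{K_v}` / `I_{K_v}`): `inv_mul_mul_mul_inv_mem_absInertia` at the completion, pushed forward.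
[cite: SerreLocalFields1979, Ch. I §7 Prop. 20–21 and §8] [cite: NeukirchANT1999, Ch. II §9 Prop. (9.6)] -/
theorem inv_mul_mul_mul_inv_mem_inertia (v : HeightOneSpectrum (𝓞 K)) {δ g : absoluteGaloisGroup K}
    (hδ : δ ∈ decomp v) (hg : g ∈ decomp v) : δ⁻¹ * g * δ * g⁻¹ ∈ inertia v := by
  obtain ⟨σ, rfl⟩ := (mem_decomp_iff v δ).mp hδ
  obtain ⟨τ, rfl⟩ := (mem_decomp_iff v g).mp hg
  refine Subgroup.mem_map.mpr ⟨σ⁻¹ * τ * σ * τ⁻¹, inv_mul_mul_mul_inv_mem_absInertia (v.adicCompletion K) σ τ, ?_⟩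
  simp only [map_mul, map_inv]
  rfl

/-- **The conjugation hypothesis of §2.** If every commutator of `Γ_K` lies in `H₂` (`Γ_K/H₂` abelian — e.g. `H₂ = ker κ₁ ⊓ ker κ₂`
for two `ℤ_p`-quotients) and `δ ∈ D_v`, then `δ^{-i} g δ^{i} g⁻¹ ∈ H₂ ⊓ I_v` for every `g ∈ H ⊓ D_v` and every `i`.
[cite: SerreLocalFields1979, Ch. I §7–§8] -/
theorem pow_inv_mul_conj_mem {H H₂ : Subgroup (absoluteGaloisGroup K)} (hab : ∀ a b : absoluteGaloisGroup K, a⁻¹ * b * a * b⁻¹ ∈ H₂)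
    (v : HeightOneSpectrum (𝓞 K)) {δ : absoluteGaloisGroup K} (hδ : δ ∈ decomp v) :
    ∀ g ∈ H ⊓ decomp v, ∀ i : ℕ, (δ ^ i)⁻¹ * g * δ ^ i * g⁻¹ ∈ H₂ ⊓ inertia v :=
  fun g hg i ↦ Subgroup.mem_inf.mpr
    ⟨hab (δ ^ i) g, inv_mul_mul_mul_inv_mem_inertia v (Subgroup.pow_mem _ hδ i) (Subgroup.mem_inf.mp hg).2⟩

omit [NumberField K] in
/-- For two `ℤ_p`-quotients `κ₁, κ₂` of `Γ_K`, every commutator lies in `ker κ₁ ⊓ ker κ₂` (`ℤ_p` is abelian).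
[cite: Washington1997, §13.1] -/
theorem inv_mul_mul_mul_inv_mem_pairKer {p : ℕ} [Fact p.Prime] (κ₁ κ₂ : ZpExtension K p) (a b : absoluteGaloisGroup K) :
    a⁻¹ * b * a * b⁻¹ ∈ ZpExtension.pairKer κ₁ κ₂ := by
  rw [ZpExtension.mem_pairKer_iff]
  constructor <;> rw [map_mul, map_mul, map_mul, map_inv, map_inv, inv_mul_cancel_comm, mul_inv_cancel]

end Commutator

end Summit.BirchSwinnertonDyer.BirchSwinnertonDyer.Theorems.UniversalToricDescentThinComb.TorsionTransferLocal

end
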